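import Summits.HodgeConjecture.CorCM.Census.DicyclicTwistClosing

/-!
# The dicyclic twist `Dic(A) ⊃ ℤ/2 × A`, VIII: the closing data, the closing span, and generators with prescribed functionals

COR-CM (cell `pub-hodgecm2`, stage 2 of the Hodge ladder), count-neutral KERNEL COMBINATORICS by the binder seat b23 (gen 42; claim
DICYCLIC-COLUMN, HOME/INBOX.md l.10328): part VIII of the lane `DicyclicTwist*`.  Bookkeeping definitions with bodies (`closData`, `f₁`, `f₂`,
`f₁x`, `f₂x`, `closingSpan`, `genU`, `genC₁`, `genU'`, `genC₀`) + theorems on top of parts I–VII; no `decide` table, no certificate, no named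
fact, no geometry, no `sorry`.  `Interfaces.lean` (C1), every E term, B01, `Transposition/*`, `PortJoin/*` untouched.
HONEST FRAMING: `HC_CM` is NOT proved, here or anywhere in the tree; nothing here is a period, a count of record or a headline.

CONTENT (`|A| = 2K + 1 ≥ 3`).  §1 CLOSING DATA `(P; u, u′, u″)`: `|P| = K − 1` and three distinct places outside `P` (a choice,
`closData_spec`); the closing squares `f₁ = (0 | 𝟙_P; u, u′)`, `f₂ = (0 | 𝟙_{P∪u}; u′, u″)` and their `x`-translates
`f₁x = (𝟙_{−P}; −u, −u′ | 1)`, `f₂x` (`translX_f₁`, `translX_f₂`).  §2 THE CLOSING SPAN: the span of the `H`-translates of `f₁, f₂, f₁x, f₂x`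
(= `ℤ[G]f₁ + ℤ[G]f₂`), inside `H₂`.  §3 GENERATORS WITH PRESCRIBED FUNCTIONALS in the closing span: `genU s` (`U_t = [t = s]`, all other
functionals `0`), `genC₁` (`C₁ = |A|`, others `0`), `genU' s`, `genC₀` — from `U(f₁ + f₂) = −e_{u′}`, `C₁ f₁ = −|A|` and the shifts of
part VII — and `gen a k₁ a′ k₀` realising any value vector `(a, |A| k₁, a′, |A| k₀)` (`U_gen`, `C₁_gen`, `U'_gen`, `C₀_gen`).  Part IX is the
generation theorem.  All [folklore].

## References
* [Pohlmann1968] H. Pohlmann, Algebraic cycles on abelian varieties of complex multiplication type, Ann. of Math. 88 (1968), Thm 1.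
-/

namespace Summit.HodgeConjecture.CorCM.Census.DicyclicTwist

open Finset
open Summit.HodgeConjecture.CorCM.Census.OddSliceFacesModel
open Summit.HodgeConjecture.CorCM.Census.OddSliceFacesSquares
open Summit.HodgeConjecture.CorCM.Census.OddSliceFacesDescent
open Summit.HodgeConjecture.CorCM.Census.EvenSliceFacesDescent
open Summit.HodgeConjecture.CorCM.Census.OddSliceFacesGenerate

variable (A : Type) [AddCommGroup A] [Fintype A] [DecidableEq A]

/-! ## §1 The closing data and the closing squares -/

omit [AddCommGroup A] in
/-- For `|A| ≥ 3` odd there are `P` with `|P| + 1 = |A|/2` and three distinct places outside `P`. [folklore] -/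
theorem exists_closData (h3 : 3 ≤ Fintype.card A) :
    ∃ d : Finset A × A × A × A, d.1.card + 1 = Fintype.card A / 2 ∧ d.2.1 ∉ d.1 ∧ d.2.2.1 ∉ d.1 ∧ d.2.2.2 ∉ d.1 ∧
      d.2.1 ≠ d.2.2.1 ∧ d.2.1 ≠ d.2.2.2 ∧ d.2.2.1 ≠ d.2.2.2 := by
  obtain ⟨a, b, c, -, -, -, hab, hac, hbc⟩ := Finset.two_lt_card_iff.mp (show 2 < (univ : Finset A).card by
    rw [Finset.card_univ]; omega)
  have hcard : Fintype.card A / 2 - 1 ≤ (univ \ {a, b, c} : Finset A).card := by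
    rw [Finset.card_univ_sdiff, Finset.card_insert_of_notMem (by simp [hab, hac]), Finset.card_pair hbc]
    omega
  obtain ⟨P, hP, hPc⟩ := Finset.exists_subset_card_eq hcard
  refine ⟨(P, a, b, c), by simp only; omega, fun h => ?_, fun h => ?_, fun h => ?_, hab, hac, hbc⟩
  · have := hP h; simp at this
  · have := hP h; simp at this
  · have := hP h; simp at this

/-- **The closing data** `(P; u, u′, u″)` (a choice; junk for `|A| < 3`). [folklore] -/
noncomputable def closData : Finset A × A × A × A :=
  if h3 : 3 ≤ Fintype.card A then (exists_closData A h3).choose else (∅, 0, 0, 0)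

/-- The properties of the closing data. [folklore] -/
theorem closData_spec (h3 : 3 ≤ Fintype.card A) :
    (closData A).1.card + 1 = Fintype.card A / 2 ∧ (closData A).2.1 ∉ (closData A).1 ∧ (closData A).2.2.1 ∉ (closData A).1 ∧
      (closData A).2.2.2 ∉ (closData A).1 ∧ (closData A).2.1 ≠ (closData A).2.2.1 ∧ (closData A).2.1 ≠ (closData A).2.2.2 ∧
      (closData A).2.2.1 ≠ (closData A).2.2.2 := by
  unfold closData; rw [dif_pos h3]; exact (exists_closData A h3).choose_spec

/-- **The first closing square** `f₁ = (0 | 𝟙_P; u, u′)` (corner weights `K−1, K, K, K+1`). [folklore] -/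
noncomputable def f₁ : Ty₂ A → ℤ := faceVec₁ A 0 (ind A (closData A).1) (closData A).2.1 (closData A).2.2.1

/-- **The second closing square** `f₂ = (0 | 𝟙_{P ∪ u}; u′, u″)` (corner weights `K, K+1, K+1, K+2`). [folklore] -/
noncomputable def f₂ : Ty₂ A → ℤ :=
  faceVec₁ A 0 (ind A (insert (closData A).2.1 (closData A).1)) (closData A).2.2.1 (closData A).2.2.2

/-- The negated place set `−P`. [folklore] -/
noncomputable def negP : Finset A := (closData A).1.image fun t => -t

/-- The `x`-translate of `f₁`: the `0`-coordinate square `(𝟙_{−P}; −u, −u′ | 1)`. [folklore] -/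
noncomputable def f₁x : Ty₂ A → ℤ := faceVec₀ A (ind A (negP A)) (-(closData A).2.1) (-(closData A).2.2.1) 1

/-- The `x`-translate of `f₂`. [folklore] -/
noncomputable def f₂x : Ty₂ A → ℤ :=
  faceVec₀ A (ind A (insert (-(closData A).2.1) (negP A))) (-(closData A).2.2.1) (-(closData A).2.2.2) 1

omit [Fintype A] in
/-- Reversal of an indicator type: `rev 𝟙_Q = 𝟙_{−Q}`. [folklore] -/
theorem rev_ind (Q : Finset A) : rev A (ind A Q) = ind A (Q.image fun t => -t) := by
  funext s
  simp only [rev, ind, Finset.mem_image]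
  by_cases h : -s ∈ Q
  · rw [if_pos h, if_pos ⟨-s, h, neg_neg s⟩]
  · rw [if_neg h, if_neg (by rintro ⟨t, ht, rfl⟩; exact h (by simpa using ht))]

omit [Fintype A] [DecidableEq A] in
/-- `rev 0 = 0`. [folklore] -/
theorem rev_zero' : rev A (0 : Ty A) = 0 := by funext s; simp [rev]

omit [Fintype A] in
/-- `insert (−u) (−P) = −(insert u P)`. [folklore] -/
theorem insert_neg_negP (u : A) (Q : Finset A) : insert (-u) (Q.image fun t => -t) = (insert u Q).image fun t => -t := by
  rw [Finset.image_insert]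

/-- **`x·f₁ = f₁x`.** [folklore] -/
theorem translX_f₁ : translX A (f₁ A) = f₁x A := by
  unfold f₁ f₁x negP
  rw [translX_faceVec₁, rev_ind, rev_zero', zero_add]

/-- **`x·f₂ = f₂x`.** [folklore] -/
theorem translX_f₂ : translX A (f₂ A) = f₂x A := by
  unfold f₂ f₂x negP
  rw [translX_faceVec₁, rev_ind, rev_zero', zero_add, ← insert_neg_negP]

/-- The negated closing data have the same shape. [folklore] -/
theorem negData_spec (h3 : 3 ≤ Fintype.card A) :
    (negP A).card + 1 = Fintype.card A / 2 ∧ -(closData A).2.1 ∉ negP A ∧ -(closData A).2.2.1 ∉ negP A ∧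
      -(closData A).2.2.2 ∉ negP A ∧ -(closData A).2.1 ≠ -(closData A).2.2.1 ∧ -(closData A).2.1 ≠ -(closData A).2.2.2 ∧
      -(closData A).2.2.1 ≠ -(closData A).2.2.2 := by
  obtain ⟨hP, hu, hu', hu'', huu', huu'', hu'u''⟩ := closData_spec A h3
  have hmem : ∀ v : A, -v ∈ negP A ↔ v ∈ (closData A).1 := fun v => by
    unfold negP; rw [Finset.mem_image]
    exact ⟨by rintro ⟨t, ht, h⟩; rwa [← neg_injective h], fun h => ⟨v, h, rfl⟩⟩
  refine ⟨?_, (hmem _).not.mpr hu, (hmem _).not.mpr hu', (hmem _).not.mpr hu'', neg_injective.ne huu', neg_injective.ne huu'',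
    neg_injective.ne hu'u''⟩
  unfold negP; rw [Finset.card_image_of_injective _ neg_injective]; exact hP

/-! ## §2 The closing span -/

/-- **The closing span**: the span of the `H`-translates of `f₁, f₂` and of their `x`-translates (`= ℤ[G]f₁ + ℤ[G]f₂`). [folklore] -/
def closingSpan : Submodule ℤ (Ty₂ A → ℤ) :=
  Submodule.span ℤ {v | ∃ g : ZMod 2 × A, v = translH A g (f₁ A) ∨ v = translH A g (f₂ A) ∨ v = translH A g (f₁x A) ∨
    v = translH A g (f₂x A)}

/-- Translates of `f₁` lie in the closing span. [folklore] -/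
theorem translH_f₁_mem (g : ZMod 2 × A) : translH A g (f₁ A) ∈ closingSpan A := Submodule.subset_span ⟨g, Or.inl rfl⟩

/-- Translates of `f₂` lie in the closing span. [folklore] -/
theorem translH_f₂_mem (g : ZMod 2 × A) : translH A g (f₂ A) ∈ closingSpan A := Submodule.subset_span ⟨g, Or.inr (Or.inl rfl)⟩

/-- Translates of `f₁x` lie in the closing span. [folklore] -/
theorem translH_f₁x_mem (g : ZMod 2 × A) : translH A g (f₁x A) ∈ closingSpan A :=
  Submodule.subset_span ⟨g, Or.inr (Or.inr (Or.inl rfl))⟩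

/-- Translates of `f₂x` lie in the closing span. [folklore] -/
theorem translH_f₂x_mem (g : ZMod 2 × A) : translH A g (f₂x A) ∈ closingSpan A :=
  Submodule.subset_span ⟨g, Or.inr (Or.inr (Or.inr rfl))⟩

omit [Fintype A] [DecidableEq A] in
/-- Translation by `0` is the identity. [folklore] -/
theorem translH_zero (v : Ty₂ A → ℤ) : translH A 0 v = v := by
  funext Ψ; simp only [translH, neg_zero, twH_zero]

/-- `f₁`, `f₁x` themselves lie in the closing span. [folklore] -/
theorem f_mem : f₁ A ∈ closingSpan A ∧ f₂ A ∈ closingSpan A ∧ f₁x A ∈ closingSpan A ∧ f₂x A ∈ closingSpan A := by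
  refine ⟨?_, ?_, ?_, ?_⟩
  · rw [← translH_zero A (f₁ A)]; exact translH_f₁_mem A 0
  · rw [← translH_zero A (f₂ A)]; exact translH_f₂_mem A 0
  · rw [← translH_zero A (f₁x A)]; exact translH_f₁x_mem A 0
  · rw [← translH_zero A (f₂x A)]; exact translH_f₂x_mem A 0

/-- **The closing span lies in `H₂`** (`|A| ≥ 3`: the places of the squares are distinct). [folklore] -/
theorem closingSpan_le_hodge₂ (h3 : 3 ≤ Fintype.card A) : closingSpan A ≤ hodge₂ A := by
  obtain ⟨-, -, -, -, huu', -, hu'u''⟩ := closData_spec A h3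
  refine Submodule.span_le.mpr ?_
  rintro v ⟨g, rfl | rfl | rfl | rfl⟩
  · exact translH_mem A (faceVec₁_mem A _ _ huu') g
  · exact translH_mem A (faceVec₁_mem A _ _ hu'u'') g
  · exact translH_mem A (faceVec₀_mem A _ (neg_injective.ne huu') _) g
  · exact translH_mem A (faceVec₀_mem A _ (neg_injective.ne hu'u'') _) g

/-! ## §3 Generators with prescribed functionals -/

/-- `genU s`: a vector of the closing span with `U_t = [t = s]` and all other functionals `0`. [folklore] -/
noncomputable def genU (s : A) : Ty₂ A → ℤ := -translH A (0, (closData A).2.2.1 - s) (f₁ A + f₂ A)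

/-- `genU' s`: `U'_t = [t = s]`, all other functionals `0`. [folklore] -/
noncomputable def genU' (s : A) : Ty₂ A → ℤ := translH A (0, -(closData A).2.2.1 - s) (f₁x A + f₂x A)

/-- `genC₁`: `C₁ = |A|`, all other functionals `0`. [folklore] -/
noncomputable def genC₁ : Ty₂ A → ℤ :=
  (∑ t ∈ univ.filter fun t => ¬ (t = (closData A).2.2.1 ∨ t = (closData A).2.1 ∨ t ∈ (closData A).1), genU A t) - f₁ A

/-- `genC₀`: `C₀ = |A|`, all other functionals `0`. [folklore] -/
noncomputable def genC₀ : Ty₂ A → ℤ :=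
  (∑ t ∈ univ.filter fun t => t = -(closData A).2.2.1 ∨ t = -(closData A).2.1 ∨ t ∈ negP A, genU' A t) - f₁x A

/-- The generators lie in the closing span. [folklore] -/
theorem gen_mem (s : A) : genU A s ∈ closingSpan A ∧ genU' A s ∈ closingSpan A ∧ genC₁ A ∈ closingSpan A ∧ genC₀ A ∈ closingSpan A := by
  have hU : ∀ t, genU A t ∈ closingSpan A := fun t => by
    unfold genU
    refine Submodule.neg_mem _ ?_
    rw [← translHHom_apply, map_add, translHHom_apply, translHHom_apply]
    exact Submodule.add_mem _ (translH_f₁_mem A _) (translH_f₂_mem A _)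
  have hU' : ∀ t, genU' A t ∈ closingSpan A := fun t => by
    unfold genU'
    rw [← translHHom_apply, map_add, translHHom_apply, translHHom_apply]
    exact Submodule.add_mem _ (translH_f₁x_mem A _) (translH_f₂x_mem A _)
  refine ⟨hU s, hU' s, ?_, ?_⟩
  · exact Submodule.sub_mem _ (Submodule.sum_mem _ fun t _ => hU t) (f_mem A).1
  · exact Submodule.sub_mem _ (Submodule.sum_mem _ fun t _ => hU' t) (f_mem A).2.2.1

/-- **The functionals of `genU s`.** [folklore] -/
theorem genU_spec (hA : Odd (Fintype.card A)) (h3 : 3 ≤ Fintype.card A) (s t : A) :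
    U A t (genU A s) = (if t = s then 1 else 0) ∧ U' A t (genU A s) = 0 ∧ C₁ A (genU A s) = 0 ∧ C₀ A (genU A s) = 0 := by
  obtain ⟨hP, hu, hu', hu'', huu', huu'', hu'u''⟩ := closData_spec A h3
  have key : (t + ((closData A).2.2.1 - s) = (closData A).2.2.1) ↔ t = s := by
    rw [← sub_eq_zero, show t + ((closData A).2.2.1 - s) - (closData A).2.2.1 = t - s by abel, sub_eq_zero]
  unfold genU f₁ f₂
  refine ⟨?_, ?_, ?_, ?_⟩
  · rw [map_neg, U_translH_zero, U_closing hA hP hu hu' hu'' huu' huu'' hu'u'']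
    simp only [key]
    split_ifs <;> simp
  · rw [map_neg, U'_translH_zero, map_add, (U'_C₀_closing hA (u'' := (closData A).2.2.2) _).1,
      (U'_C₀_closing hA (u'' := (closData A).2.2.2) _).2.1]; simp
  · rw [map_neg, C₁_translH_zero A hA, map_add, (C₁_closing hA hP hu hu' hu'' huu' huu'' hu'u'').1,
      (C₁_closing hA hP hu hu' hu'' huu' huu'' hu'u'').2]; simp
  · rw [map_neg, C₀_translH_zero A hA, map_add, (U'_C₀_closing hA (u'' := (closData A).2.2.2) s).2.2.1,
      (U'_C₀_closing hA (u'' := (closData A).2.2.2) s).2.2.2]; simp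

/-- **The functionals of `genU' s`.** [folklore] -/
theorem genU'_spec (hA : Odd (Fintype.card A)) (h3 : 3 ≤ Fintype.card A) (s t : A) :
    U' A t (genU' A s) = (if t = s then 1 else 0) ∧ U A t (genU' A s) = 0 ∧ C₀ A (genU' A s) = 0 ∧ C₁ A (genU' A s) = 0 := by
  obtain ⟨hP, hu, hu', hu'', huu', huu'', hu'u''⟩ := negData_spec A h3
  have key : (t + (-(closData A).2.2.1 - s) = -(closData A).2.2.1) ↔ t = s := by
    rw [← sub_eq_zero, show t + (-(closData A).2.2.1 - s) - -(closData A).2.2.1 = t - s by abel, sub_eq_zero]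
  unfold genU' f₁x f₂x
  refine ⟨?_, ?_, ?_, ?_⟩
  · rw [U'_translH_zero, U'_closing hA hP hu hu' hu'' huu' huu'' hu'u'']
    simp only [key]
  · rw [U_translH_zero, map_add, (C₀_closing hA hP hu hu' hu'' huu' huu'' hu'u'' _).2.2.1,
      (C₀_closing hA hP hu hu' hu'' huu' huu'' hu'u'' _).2.2.2.1]; simp
  · rw [C₀_translH_zero A hA, map_add, (C₀_closing hA hP hu hu' hu'' huu' huu'' hu'u'' s).1,
      (C₀_closing hA hP hu hu' hu'' huu' huu'' hu'u'' s).2.1]; simp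
  · rw [C₁_translH_zero A hA, map_add, (C₀_closing hA hP hu hu' hu'' huu' huu'' hu'u'' s).2.2.2.2.1,
      (C₀_closing hA hP hu hu' hu'' huu' huu'' hu'u'' s).2.2.2.2.2]; simp

/-- **The functionals of `genC₁`.** [folklore] -/
theorem genC₁_spec (hA : Odd (Fintype.card A)) (h3 : 3 ≤ Fintype.card A) (t : A) :
    U A t (genC₁ A) = 0 ∧ U' A t (genC₁ A) = 0 ∧ C₁ A (genC₁ A) = Fintype.card A ∧ C₀ A (genC₁ A) = 0 := by
  obtain ⟨hP, hu, hu', hu'', huu', huu'', hu'u''⟩ := closData_spec A h3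
  have gU : ∀ s, U A t (genU A s) = if t = s then 1 else 0 := fun s => (genU_spec A hA h3 s t).1
  have gU' : ∀ s, U' A t (genU A s) = 0 := fun s => (genU_spec A hA h3 s t).2.1
  have gC₁ : ∀ s, C₁ A (genU A s) = 0 := fun s => (genU_spec A hA h3 s s).2.2.1
  have gC₀ : ∀ s, C₀ A (genU A s) = 0 := fun s => (genU_spec A hA h3 s s).2.2.2
  unfold genC₁
  refine ⟨?_, ?_, ?_, ?_⟩
  · rw [map_sub, map_sum]
    simp only [gU]
    unfold f₁
    rw [U_f₁ hA hP hu hu' hu'' huu' huu'' hu'u'', Finset.sum_ite_eq]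
    simp only [Finset.mem_filter, Finset.mem_univ, true_and]
    by_cases h : t = (closData A).2.2.1 ∨ t = (closData A).2.1 ∨ t ∈ (closData A).1
    · rw [if_neg (not_not.mpr h), if_pos h]; simp
    · rw [if_pos h, if_neg h]; simp
  · rw [map_sub, map_sum]
    simp only [gU', Finset.sum_const_zero, zero_sub, neg_eq_zero]
    unfold f₁; exact (U'_C₀_closing hA (u'' := (closData A).2.2.2) t).1
  · rw [map_sub, map_sum]
    simp only [gC₁, Finset.sum_const_zero, zero_sub]
    unfold f₁; rw [(C₁_closing hA hP hu hu' hu'' huu' huu'' hu'u'').1]; simp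
  · rw [map_sub, map_sum]
    simp only [gC₀, Finset.sum_const_zero, zero_sub, neg_eq_zero]
    unfold f₁; exact (U'_C₀_closing hA (u'' := (closData A).2.2.2) t).2.2.1

/-- **The functionals of `genC₀`.** [folklore] -/
theorem genC₀_spec (hA : Odd (Fintype.card A)) (h3 : 3 ≤ Fintype.card A) (t : A) :
    U A t (genC₀ A) = 0 ∧ U' A t (genC₀ A) = 0 ∧ C₁ A (genC₀ A) = 0 ∧ C₀ A (genC₀ A) = Fintype.card A := by
  obtain ⟨hP, hu, hu', hu'', huu', huu'', hu'u''⟩ := negData_spec A h3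
  have gU' : ∀ s, U' A t (genU' A s) = if t = s then 1 else 0 := fun s => (genU'_spec A hA h3 s t).1
  have gU : ∀ s, U A t (genU' A s) = 0 := fun s => (genU'_spec A hA h3 s t).2.1
  have gC₀ : ∀ s, C₀ A (genU' A s) = 0 := fun s => (genU'_spec A hA h3 s s).2.2.1
  have gC₁ : ∀ s, C₁ A (genU' A s) = 0 := fun s => (genU'_spec A hA h3 s s).2.2.2
  unfold genC₀
  refine ⟨?_, ?_, ?_, ?_⟩
  · rw [map_sub, map_sum]
    simp only [gU, Finset.sum_const_zero, zero_sub, neg_eq_zero]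
    unfold f₁x; exact (C₀_closing hA hP hu hu' hu'' huu' huu'' hu'u'' t).2.2.1
  · rw [map_sub, map_sum]
    simp only [gU']
    unfold f₁x
    rw [U'_f₁x hA hP hu hu' hu'' huu' huu'' hu'u'', Finset.sum_ite_eq]
    simp only [Finset.mem_filter, Finset.mem_univ, true_and]
    by_cases h : t = -(closData A).2.2.1 ∨ t = -(closData A).2.1 ∨ t ∈ negP A
    · rw [if_pos h]; simp
    · rw [if_neg h]; simp
  · rw [map_sub, map_sum]
    simp only [gC₁, Finset.sum_const_zero, zero_sub, neg_eq_zero]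
    unfold f₁x; exact (C₀_closing hA hP hu hu' hu'' huu' huu'' hu'u'' t).2.2.2.2.1
  · rw [map_sub, map_sum]
    simp only [gC₀, Finset.sum_const_zero, zero_sub]
    unfold f₁x; rw [(C₀_closing hA hP hu hu' hu'' huu' huu'' hu'u'' t).1]; simp

end Summit.HodgeConjecture.CorCM.Census.DicyclicTwist
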